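import Literature.MathematicalPhysics.QuantumFieldTheory.Balaban1983to89.T3AlphaInputsAC
import Summits.QuantumFields.YangMills.Theorems.UnitScaleTiltFluctuationComparisonRegPrSocketLevels
import Summits.QuantumFields.YangMills.Theorems.UnitScaleTiltFluctuationComparisonRegPrBudget
import HarnessLib

/-!
# Route `UnitScaleTilt` — crux K1bR-pr `FluctuationComparisonRegPr` (stmt-QuantumFields-19201), stub `stub_logComparisonRegPr` /
# v5 `stub_cauchyOfLocalRep`: the interface's cut-off-Cauchy schema `CauchyAtHeights D` FROM ITS LEVEL-BY-LEVEL FORM over the interface's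
# localised data (support file `--supports stmt-QuantumFields-19201`; the stub stays open)

Fleet lead `ym-ust-19201-p2` (gen 0).  The α interface `T3AlphaInputsAC` (p452599) exposes run `K`'s interaction sum as localised data:
`PintDecomp D : Pint K j h W = Σ_{i ∈ [1,j]} Σ_{Y ∈ Loc K j h i} Pterm K i Y (Umin K j h W)` ([Balaban1985UV3] (43)); its height reading `PintH D K n`
is the argument of the sockets `TwoSidedRepAt`/`PintCauchyAt` (`RepAtHeights`/`CauchyAtHeights`).  THIS FILE reads the decomposition at the
comparison height and plugs it into the level socket `LevelCauchyAt` (p450546) / `pintCauchyAt_of_levelwise` (p450868):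

* `levelData D K j n V` — the STEP-`j` part of `PintH D K n V`: the level-`(1+j)` localised terms of run `K` at the trivial history, evaluated at
  the trivial-history composite minimiser of the datum `V` read up (`j < K − n`; `0` above the cut-off);
* `PintH_eq_sum_levelData` — under `PintDecomp D`, `PintH D K n V = Σ_{j < K−n} levelData D K j n V` for ALL `K n` (above the cut-off both sides vanish);
* **`cauchyAtHeights_of_levelwise`** — `PintDecomp D → LevelCauchyAt F γ b₀ p₀ m (levelData D) → CauchyAtHeights D b₀ p₀ m`: the v5 stub
  `stub_cauchyOfLocalRep`'s conclusion from per-LEVEL matched comparisons (run `K+1` step `j+1` vs run `K` step `j`) and the extra finest slice —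
  [King1986]'s replacement scheme at step granularity for Bałaban's localised terms.  consumes: `PintDecomp` (the REQUIRED locality clause of
  owner ruling g15-№1 (2)), every clause of `LevelCauchyAt`;
* **`rmH_clauses_of_rmSize`** — the two `Rm`-clauses of `RepAtHeights D b₀ p₀ ε₀ = TwoSidedRepAt … D.RmH` (non-negativity of `RmH`; summability of
  `K ↦ RmH K ⌊K/m⌋ + RmH (K+1) ⌊K/m⌋` for every `m ≥ 1`) FROM THE INTERFACE'S PRINTED SIZE `RmSize D C q` alone (`LogComparisonBudget.rmH_clauses_of_size`,
  p453126): whoever proves `RepAtHeights` for a constructed `D` needs only the a.e. envelope clause beyond print's (41) remainder size.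

References: C. King, CMP 102 (1986) 649–677 [King1986] (Thm 3.4 (3.9) p.656; §3.4–3.6); T. Bałaban, CMP 102 (1985) 255–275 [Balaban1985UV3] ((43) p.266).
-/

noncomputable section

open MeasureTheory Filter Topology
open Literature.MathematicalPhysics.QuantumFieldTheory.Balaban1983to89
open Literature.MathematicalPhysics.QuantumFieldTheory.Balaban1983to89.T3ContinuumYM3Torus
open Literature.MathematicalPhysics.QuantumFieldTheory.Balaban1983to89.T3LevelShift
open Literature.MathematicalPhysics.QuantumFieldTheory.Balaban1983to89.T3UnitLawDensityEML (ℰp measurableE_ℰp)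
open Literature.MathematicalPhysics.QuantumFieldTheory.Balaban1983to89.T3UnitScaleTilt
open Literature.MathematicalPhysics.QuantumFieldTheory.Balaban1983to89.T3TiltDescent
open Literature.MathematicalPhysics.QuantumFieldTheory.Balaban1983to89.T3LogComparisonSocket
open Literature.MathematicalPhysics.QuantumFieldTheory.Balaban1983to89.T3AlphaInputsAC
open Literature.MathematicalPhysics.QuantumFieldTheory.Balaban1983to89.Missing

namespace Summit.QuantumFields.YangMills.Theorems.LogComparisonSocketLevelsAlpha

variable {F : T3Family} {γ : ℝ} (D : AlphaDataT3 F γ)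

/-- **THE STEP-`j` PART OF THE HEIGHT READING OF THE INTERACTION SUM**: run `K`, comparison height `n` (`k = K − n` steps), step `j < k`: the sum
of the level-`(1+j)` localised terms `𝒫_{1+j}(Y, U_k(V))` over print's localisation domains at the trivial history, the datum `V` read on run `K`'s
tower exactly as `PintH` reads it; `0` above the cut-off (`K < n`). [cite: Balaban1985UV3, (43) p.266] -/
def levelData (K j n : ℕ) (V : GaugeField (F.P n) 0 (Matrix.specialUnitaryGroup (Fin 2) ℂ)) : ℝ :=
  if h : n ≤ K then
    ∑ Y ∈ D.Loc K (K - n) (D.triv K (K - n)) (1 + j),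
      D.Pterm K (1 + j) Y (D.Umin K (K - n) (D.triv K (K - n))
        (fieldShift (F.sitesPerDir_eq (m := F.m) (K := K) (j := K - n) (m' := F.m) (K' := n) (j' := 0) (by omega)) V))
  else 0

/-- **THE HEIGHT READING DECOMPOSES BY STEPS**: under the interface's (43)-clause `PintDecomp D`, `PintH D K n V = Σ_{j<K−n} levelData D K j n V`
for all `K`, `n`, `V` (for `K < n` both sides are `0`). [cite: Balaban1985UV3, (43) p.266] -/
theorem PintH_eq_sum_levelData (hdec : PintDecomp D) (K n : ℕ) (V : GaugeField (F.P n) 0 (Matrix.specialUnitaryGroup (Fin 2) ℂ)) :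
    D.PintH K n V = ∑ j ∈ Finset.range (K - n), levelData D K j n V := by
  by_cases h : n ≤ K
  · rw [D.PintH_of_le h]
    unfold AlphaDataT3.PintTriv
    rw [hdec, ← Finset.Ico_add_one_right_eq_Icc, Finset.sum_Ico_eq_sum_range, Nat.add_sub_cancel]
    refine Finset.sum_congr rfl fun j _ => ?_
    simp only [levelData, dif_pos h]
  · have hK : K - n = 0 := by omega
    simp only [AlphaDataT3.PintH, dif_neg h, hK, Finset.range_zero, Finset.sum_empty]

/-- **`CauchyAtHeights` FROM ITS LEVEL-BY-LEVEL FORM OVER THE INTERFACE'S LOCALISED DATA** (the v5 stub `stub_cauchyOfLocalRep`'s conclusion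
from per-step matched comparisons + the extra finest slice, [King1986]'s replacement scheme at step granularity): `PintDecomp D` and
`LevelCauchyAt F γ b₀ p₀ m (levelData D)` give `CauchyAtHeights D b₀ p₀ m`. [cite: King1986, Thm 3.4 (3.9) p.656] -/
theorem cauchyAtHeights_of_levelwise (hdec : PintDecomp D) (b₀ p₀ : ℝ) (m : ℕ)
    (h : LevelCauchyAt F γ b₀ p₀ m (levelData D)) : CauchyAtHeights D b₀ p₀ m :=
  Summit.QuantumFields.YangMills.Theorems.LogComparisonSocketLevels.pintCauchyAt_of_levelwise F γ b₀ p₀ m (levelData D) D.PintH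
    (fun K n V => PintH_eq_sum_levelData D hdec K n V) h

/-- **THE `Rm`-CLAUSES OF `RepAtHeights` FROM THE PRINTED REMAINDER SIZE**: `RmSize D C q` ([Balaban1985UV3] (41) last term, `q = L^{−κ₀}`) gives
`0 ≤ D.RmH K n` for all `K n` and, for every `m ≥ 1`, `Σ_K (D.RmH K ⌊K/m⌋ + D.RmH (K+1) ⌊K/m⌋) < ∞` — the first two clauses of
`TwoSidedRepAt F γ b₀ p₀ ε₀ D.PintH D.EcstH D.RmH`. [cite: Balaban1985UV3, (41) p.266] -/
theorem rmH_clauses_of_rmSize {C q : ℝ} (h : RmSize D C q) :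
    (∀ K n : ℕ, 0 ≤ D.RmH K n) ∧ ∀ m : ℕ, 0 < m → Summable fun K : ℕ => D.RmH K (K / m) + D.RmH (K + 1) (K / m) :=
  Summit.QuantumFields.YangMills.Theorems.LogComparisonBudget.rmH_clauses_of_size (Rm := D.Rm) h.1 h.2.1 (by positivity) h.2.2

/-! ## §2 Summing the localisation domains: `LocCover` ⇒ a volume bound on `Σ_{Y ∈ Loc} e^{−κ₁𝓛(Y)}` (the S-E″ summability step) -/

/-- **SUMMING THE PRINTED DECAY OVER ALL LOCALISATION DOMAINS OF ONE LEVEL**: under `LocCover D κ₁ C′` (tree lengths `≥ 0`, `Σ_{Y ∋ y} e^{−κ₁𝓛(Y)} ≤ C′`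
for every site `y`) and `κ₁ ≥ 0`, `Σ_{Y ∈ Loc K j h i} e^{−κ₁𝓛(Y)} ≤ C′·#sites + 1` (every non-empty domain is counted at one of its sites; the empty set, if
listed, contributes at most `1`) — the volume factor `|T₁^{(j)}|`-type bookkeeping of [Balaban1985UV3] (45)–(46) p.267 «summation over y gives the factor …».
[cite: Balaban1985UV3, (45)-(46) p.267] -/
theorem sum_loc_exp_le_of_locCover {κ₁ C' : ℝ} (hκ : 0 ≤ κ₁) (hLC : LocCover D κ₁ C') (K j : ℕ) (h : D.Hist K j) (i : ℕ) :
    ∑ Y ∈ D.Loc K j h i, Real.exp (-κ₁ * D.treeLen K i Y) ≤ C' * Fintype.card (Site (F.P K) 0) + 1 := by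
  classical
  set f : Set (Site (F.P K) 0) → ℝ := fun Y => Real.exp (-κ₁ * D.treeLen K i Y) with hf
  have hf0 : ∀ Y, 0 ≤ f Y := fun Y => Real.exp_nonneg _
  have hf1 : ∀ Y, f Y ≤ 1 := fun Y => by
    rw [hf]
    exact Real.exp_le_one_iff.mpr (by nlinarith [hLC.1 K i Y])
  -- each domain is dominated by its site-count plus an indicator of emptiness
  have hdom : ∀ Y ∈ D.Loc K j h i,
      f Y ≤ (∑ y : Site (F.P K) 0, Y.indicator (fun _ => f Y) y) + (if Y = ∅ then (1 : ℝ) else 0) := by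
    intro Y _
    by_cases hY : Y = ∅
    · rw [if_pos hY]
      have h0 : 0 ≤ ∑ y : Site (F.P K) 0, Y.indicator (fun _ => f Y) y :=
        Finset.sum_nonneg fun y _ => Set.indicator_nonneg (fun _ _ => hf0 Y) _
      linarith [hf1 Y]
    · rw [if_neg hY, add_zero]
      obtain ⟨y₀, hy₀⟩ := Set.nonempty_iff_ne_empty.mpr hY
      have hle := Finset.single_le_sum (f := fun y => Y.indicator (fun _ => f Y) y)
        (fun y _ => Set.indicator_nonneg (fun _ _ => hf0 Y) _) (Finset.mem_univ y₀)
      simpa [Set.indicator_of_mem hy₀] using hle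
  calc ∑ Y ∈ D.Loc K j h i, f Y
      ≤ ∑ Y ∈ D.Loc K j h i, ((∑ y : Site (F.P K) 0, Y.indicator (fun _ => f Y) y) + (if Y = ∅ then (1 : ℝ) else 0)) :=
        Finset.sum_le_sum hdom
    _ = (∑ y : Site (F.P K) 0, ∑ Y ∈ D.Loc K j h i, Y.indicator (fun _ => f Y) y) +
          ∑ Y ∈ D.Loc K j h i, (if Y = ∅ then (1 : ℝ) else 0) := by
        rw [Finset.sum_add_distrib, Finset.sum_comm]
    _ ≤ (∑ _y : Site (F.P K) 0, C') + 1 := by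
        gcongr with y _
        · exact hLC.2 K j h i y
        · rw [Finset.sum_boole]
          have hsub : (D.Loc K j h i).filter (fun Y => Y = ∅) ⊆ {∅} := by
            intro Y hY
            rw [Finset.mem_filter] at hY
            rw [Finset.mem_singleton]
            exact hY.2
          have hcard := Finset.card_le_card hsub
          rw [Finset.card_singleton] at hcard
          exact_mod_cast hcard
    _ = C' * Fintype.card (Site (F.P K) 0) + 1 := by
        rw [Finset.sum_const, Finset.card_univ, nsmul_eq_mul, mul_comm]

/-- **THE SAME WITH THE BLOCK VOLUME DIVIDED OUT** (the count print uses: (45) p.267 sums over the sites `y₀` of the CURRENT lattice `T^{(j)}`, i.e. over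
big blocks, not over fine sites): if every listed level-`i` localisation domain contains at least `N > 0` fine sites (stated as `N ≤ Σ_y 1_Y(y)`; for print's
domains `N = (M₁Lⁱ)³`), then `Σ_{Y ∈ Loc K j h i} e^{−κ₁𝓛(Y)} ≤ C′·#(fine sites)/N` — each domain is counted at ≥ `N` of its sites.  With `#(fine sites) =
(2L^{F.m+K})³` and `N = (M₁Lⁱ)³` this is the level-`i` volume `|T₁^{(i)}|`-bookkeeping the S-E″ summability needs (the `N = 1` lemma above overcounts by `L^{3i}`).
[cite: Balaban1985UV3, (45)-(46) p.267] -/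
theorem sum_loc_exp_le_of_locCover_of_volume {κ₁ C' : ℝ} (hLC : LocCover D κ₁ C') (K j : ℕ) (h : D.Hist K j) (i : ℕ)
    {N : ℝ} (hN : 0 < N)
    (hvol : ∀ Y ∈ D.Loc K j h i, N ≤ ∑ y : Site (F.P K) 0, Y.indicator (fun _ => (1 : ℝ)) y) :
    ∑ Y ∈ D.Loc K j h i, Real.exp (-κ₁ * D.treeLen K i Y) ≤ C' * Fintype.card (Site (F.P K) 0) / N := by
  set f : Set (Site (F.P K) 0) → ℝ := fun Y => Real.exp (-κ₁ * D.treeLen K i Y) with hf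
  have hf0 : ∀ Y, 0 ≤ f Y := fun Y => Real.exp_nonneg _
  -- `N·f(Y) ≤ Σ_y 1_Y(y)·f(Y)` for every listed domain
  have hdom : ∀ Y ∈ D.Loc K j h i, N * f Y ≤ ∑ y : Site (F.P K) 0, Y.indicator (fun _ => f Y) y := by
    intro Y hY
    have hsum : ∑ y : Site (F.P K) 0, Y.indicator (fun _ => f Y) y = (∑ y : Site (F.P K) 0, Y.indicator (fun _ => (1 : ℝ)) y) * f Y := by
      rw [Finset.sum_mul]
      refine Finset.sum_congr rfl fun y _ => ?_
      by_cases hy : y ∈ Y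
      · rw [Set.indicator_of_mem hy, Set.indicator_of_mem hy, one_mul]
      · rw [Set.indicator_of_notMem hy, Set.indicator_of_notMem hy, zero_mul]
    rw [hsum]
    exact mul_le_mul_of_nonneg_right (hvol Y hY) (hf0 Y)
  have hmain : N * ∑ Y ∈ D.Loc K j h i, f Y ≤ C' * Fintype.card (Site (F.P K) 0) := by
    calc N * ∑ Y ∈ D.Loc K j h i, f Y = ∑ Y ∈ D.Loc K j h i, N * f Y := by rw [Finset.mul_sum]
      _ ≤ ∑ Y ∈ D.Loc K j h i, ∑ y : Site (F.P K) 0, Y.indicator (fun _ => f Y) y := Finset.sum_le_sum hdom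
      _ = ∑ y : Site (F.P K) 0, ∑ Y ∈ D.Loc K j h i, Y.indicator (fun _ => f Y) y := Finset.sum_comm
      _ ≤ ∑ _y : Site (F.P K) 0, C' := Finset.sum_le_sum fun y _ => hLC.2 K j h i y
      _ = C' * Fintype.card (Site (F.P K) 0) := by rw [Finset.sum_const, Finset.card_univ, nsmul_eq_mul, mul_comm]
  rw [le_div_iff₀ hN, mul_comm]
  exact hmain

end Summit.QuantumFields.YangMills.Theorems.LogComparisonSocketLevelsAlpha

end
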